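import Mathlib
import Summits.ResolutionOfSingularities.ResolutionOfSingularities.Theorems.WildQuotientsWildQuotientResolutionJordanThreeChartsB

/-!
# Programme V4U (J₄ toric exit): the smooth vertex chart `D₊(x_c⁶ t)` of `Bl_{I₆} 𝔸ⁿ` is an affine space

(crux stmt-ResolutionOfSingularities-15640 `WildQuotients.WildQuotientResolution`, line `Sketch`,
sector `|G| = p`; programme V4U of `L/w45c/CHAIN.md` v5 §NEXT / RULING v5.1 (5): `J₄`
(`JordanBlockFourfold`, stmt-…-17942) by the toric exit with weights `(3,2,1)`;
[OURS · L1 W4.5c] — NOT a statement of any manuscript.)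

`I₆ = (x_a², x_a x_b², x_a x_b x_c, x_a x_c³, x_b³, x_b² x_c², x_b x_c⁴, x_c⁶)` = the monomials of
`(3,2,1)`-weight `≥ 6` in the `J₄`-coordinates `(x_a, x_b, x_c)` (the fourth coordinate and the rest are
passengers); `Bl_{I₆} 𝔸ⁿ` is the toric variety of the star subdivision of the octant at `(3,2,1)`:
three vertex charts, `D₊(x_a² t)` (a `⅓(1,1,2)` quotient singularity), `D₊(x_b³ t)` (`½(1,1,1)`), and
the SMOOTH chart `D₊(x_c⁶ t) = Spec k[v, u, x_c, …]`, `v = x_a/x_c³`, `u = x_b/x_c²` — this file: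
`isRegularRing_chartRing_I6_c` (generic engine `JordanThree.isRegularRing_chartRing_of_chartData`,
p482519). GENERATOR VECTOR (literal, order of res-L1-w45c-plan-1 RULING v5.1 (5)):
`![X a ^ 2, X a * X b ^ 2, X a * X b * X c, X a * X c ^ 3, X b ^ 3, X b ^ 2 * X c ^ 2, X b * X c ^ 4, X c ^ 6]`.
-/

-- single-problem summit: the doubled namespace component `ResolutionOfSingularities` is forced
set_option linter.dupNamespace false

noncomputable section

open MvPolynomial IsLocalization AlgebraicGeometry Literature.AlgebraicGeometry.Resolution

namespace Summit.ResolutionOfSingularities.ResolutionOfSingularities.Theorems.WildQuotientResolution.JordanFour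

/-- **Chart `D₊(x_c⁶ t)` of `Bl_{I₆} 𝔸ⁿ` is regular** (the smooth cone `{e_a, e_b, (3,2,1)}`): its
ring is `k[x][I₆/x_c⁶] = k[v, u, x_c, (x_s)_{s ≠ a,b,c}]`, `v = x_a/x_c³`, `u = x_b/x_c²` — chart map
`x_a ↦ x_a x_c³/x_c⁶`, `x_b ↦ x_b x_c⁴/x_c⁶`, retracted by `x_a ↦ x_a x_c³`, `x_b ↦ x_b x_c²`; the
eight generators become `v², v u² x_c, v u, v, u³, u², u, 1`. [OURS · L1 W4.5c] [folklore] -/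
theorem isRegularRing_chartRing_I6_c (k : Type) [Field k] (n : ℕ) (a b c : Fin n)
    (hab : a ≠ b) (hbc : b ≠ c) (hac : a ≠ c) :
    IsRegularRing (chartRing
      (![X a ^ 2, X a * X b ^ 2, X a * X b * X c, X a * X c ^ 3, X b ^ 3, X b ^ 2 * X c ^ 2,
          X b * X c ^ 4, X c ^ 6] : Fin 8 → MvPolynomial (Fin n) k) 7) := by
  classical
  set g : Fin 8 → MvPolynomial (Fin n) k :=
    ![X a ^ 2, X a * X b ^ 2, X a * X b * X c, X a * X c ^ 3, X b ^ 3, X b ^ 2 * X c ^ 2,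
      X b * X c ^ 4, X c ^ 6] with hg
  have hg0 : g 0 = X a ^ 2 := rfl
  have hg1 : g 1 = X a * X b ^ 2 := rfl
  have hg2 : g 2 = X a * X b * X c := rfl
  have hg3 : g 3 = X a * X c ^ 3 := rfl
  have hg4 : g 4 = X b ^ 3 := rfl
  have hg5 : g 5 = X b ^ 2 * X c ^ 2 := rfl
  have hg6 : g 6 = X b * X c ^ 4 := rfl
  have hg7 : g 7 = X c ^ 6 := rfl
  have hba : b ≠ a := fun h => hab h.symm
  have hca : c ≠ a := fun h => hac h.symm
  have hcb : c ≠ b := fun h => hbc h.symm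
  set L := Localization.Away (g 7)
  set ι := algebraMap (MvPolynomial (Fin n) k) L with hιdef
  have hu : ι (g 7) * Away.invSelf (g 7) = 1 := Away.mul_invSelf (g 7)
  let Θ : MvPolynomial (Fin n) k →ₐ[k] L :=
    aeval fun s => if s = a then ι (g 3) * Away.invSelf (g 7)
      else if s = b then ι (g 6) * Away.invSelf (g 7) else ι (X s)
  let ω : MvPolynomial (Fin n) k →ₐ[k] MvPolynomial (Fin n) k :=
    aeval fun s => if s = a then X a * X c ^ 3 else if s = b then X b * X c ^ 2 else X s
  have hΘa : Θ (X a) = ι (g 3) * Away.invSelf (g 7) := by simp [Θ]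
  have hΘb : Θ (X b) = ι (g 6) * Away.invSelf (g 7) := by simp [Θ, hba]
  have hΘs : ∀ s, s ≠ a → s ≠ b → Θ (X s) = ι (X s) := fun s hs hs' => by simp [Θ, hs, hs']
  have hΘc : Θ (X c) = ι (X c) := hΘs c hca hcb
  have hωa : ω (X a) = X a * X c ^ 3 := by simp [ω]
  have hωb : ω (X b) = X b * X c ^ 2 := by simp [ω, hba]
  have hωs : ∀ s, s ≠ a → s ≠ b → ω (X s) = X s := fun s hs hs' => by simp [ω, hs, hs']
  have hωc : ω (X c) = X c := hωs c hca hcb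
  have hωg7 : ω (g 7) = g 7 := by rw [hg7, map_pow, hωc]
  have E := fun (A B : MvPolynomial (Fin n) k) (d d' : ℕ) (h : A * g 7 ^ d' = B * g 7 ^ d) =>
    JordanThree.algebraMap_mul_invSelf_pow_eq (g 7) A B d d' h
  refine JordanThree.isRegularRing_chartRing_of_chartData g 7 ?_ Θ ω ?_ ?_ ?_ ?_ ?_
  · rw [hg7]; exact pow_ne_zero _ (X_ne_zero c)
  · intro s
    by_cases hs : s = a
    · subst hs
      rw [hωa, map_mul, map_pow, hΘa, hΘc]
      have key := E (g 3 * X c ^ 3) (X s) 1 0 (by rw [hg3, hg7]; ring)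
      rw [pow_one, pow_zero, mul_one, map_mul, map_pow] at key
      rw [← key]
      ring
    · by_cases hs' : s = b
      · subst hs'
        rw [hωb, map_mul, map_pow, hΘb, hΘc]
        have key := E (g 6 * X c ^ 2) (X s) 1 0 (by rw [hg6, hg7]; ring)
        rw [pow_one, pow_zero, mul_one, map_mul, map_pow] at key
        rw [← key]
        ring
      · rw [hωs s hs hs', hΘs s hs hs']
  · intro s
    by_cases hs : s = a
    · subst hs
      rw [hΘa]
      exact div_mem_blowupAlgebra _ _ (Ideal.mem_span_range_self (f := g) (x := 3))
    · by_cases hs' : s = b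
      · subst hs'
        rw [hΘb]
        exact div_mem_blowupAlgebra _ _ (Ideal.mem_span_range_self (f := g) (x := 6))
      · rw [hΘs s hs hs']
        exact Subalgebra.algebraMap_mem _ _
  · intro j
    fin_cases j
    · -- x_a² / x_c⁶ = v²
      refine ⟨X a ^ 2, ?_⟩
      change Θ _ = ι (g 0) * _
      have key := E (g 3 ^ 2) (g 0) 2 1 (by rw [hg3, hg7, hg0]; ring)
      rw [pow_one, map_pow] at key
      rw [map_pow, hΘa, ← key]
      ring
    · -- x_a x_b² / x_c⁶ = v u² x_c
      refine ⟨X a * X b ^ 2 * X c, ?_⟩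
      change Θ _ = ι (g 1) * _
      have key := E (g 3 * g 6 ^ 2 * X c) (g 1) 3 1 (by rw [hg3, hg6, hg7, hg1]; ring)
      rw [pow_one, map_mul, map_mul, map_pow] at key
      rw [map_mul, map_mul, map_pow, hΘa, hΘb, hΘc, ← key]
      ring
    · -- x_a x_b x_c / x_c⁶ = v u
      refine ⟨X a * X b, ?_⟩
      change Θ _ = ι (g 2) * _
      have key := E (g 3 * g 6) (g 2) 2 1 (by rw [hg3, hg6, hg7, hg2]; ring)
      rw [pow_one, map_mul] at key
      rw [map_mul, hΘa, hΘb, ← key]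
      ring
    · exact ⟨X a, hΘa⟩
    · -- x_b³ / x_c⁶ = u³
      refine ⟨X b ^ 3, ?_⟩
      change Θ _ = ι (g 4) * _
      have key := E (g 6 ^ 3) (g 4) 3 1 (by rw [hg6, hg7, hg4]; ring)
      rw [pow_one, map_pow] at key
      rw [map_pow, hΘb, ← key]
      ring
    · -- x_b² x_c² / x_c⁶ = u²
      refine ⟨X b ^ 2, ?_⟩
      change Θ _ = ι (g 5) * _
      have key := E (g 6 ^ 2) (g 5) 2 1 (by rw [hg6, hg7, hg5]; ring)
      rw [pow_one, map_pow] at key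
      rw [map_pow, hΘb, ← key]
      ring
    · exact ⟨X b, hΘb⟩
    · refine ⟨1, ?_⟩
      change Θ 1 = ι (g 7) * _
      rw [map_one, hu]
  · exact ⟨1, 1, by rw [hωg7, mul_one, pow_one]⟩
  · intro s
    by_cases hs : s = a
    · subst hs
      refine ⟨g 3, 1, by rw [hΘa, pow_one], ?_⟩
      rw [pow_one, hωg7, hg3, hg7, map_mul, map_pow, hωa, hωc]
      ring
    · by_cases hs' : s = b
      · subst hs'
        refine ⟨g 6, 1, by rw [hΘb, pow_one], ?_⟩
        rw [pow_one, hωg7, hg6, hg7, map_mul, map_pow, hωb, hωc]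
        ring
      · exact ⟨X s, 0, by rw [hΘs s hs hs', pow_zero, mul_one],
          by rw [pow_zero, mul_one, hωs s hs hs']⟩


section Containments

variable (k : Type) [Field k] (n : ℕ) (a b c : Fin n)

/-- In the Rees algebra of `I₆`: `(x_a x_c³ t)² = (x_a² t)(x_c⁶ t)` (the generator `x_a x_c³` is the
midpoint of the edge `x_a²—x_c⁶`). [folklore] -/
theorem reesT_I6_three_sq :
    reesT ((![X a ^ 2, X a * X b ^ 2, X a * X b * X c, X a * X c ^ 3, X b ^ 3, X b ^ 2 * X c ^ 2,
          X b * X c ^ 4, X c ^ 6] : Fin 8 → MvPolynomial (Fin n) k) 3) (Ideal.mem_span_range_self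
        (f := (![X a ^ 2, X a * X b ^ 2, X a * X b * X c, X a * X c ^ 3, X b ^ 3, X b ^ 2 * X c ^ 2,
          X b * X c ^ 4, X c ^ 6] : Fin 8 → MvPolynomial (Fin n) k)) (x := 3)) ^ 2 =
    reesT ((![X a ^ 2, X a * X b ^ 2, X a * X b * X c, X a * X c ^ 3, X b ^ 3, X b ^ 2 * X c ^ 2,
          X b * X c ^ 4, X c ^ 6] : Fin 8 → MvPolynomial (Fin n) k) 0) (Ideal.mem_span_range_self
        (f := (![X a ^ 2, X a * X b ^ 2, X a * X b * X c, X a * X c ^ 3, X b ^ 3, X b ^ 2 * X c ^ 2,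
          X b * X c ^ 4, X c ^ 6] : Fin 8 → MvPolynomial (Fin n) k)) (x := 0)) *
      reesT ((![X a ^ 2, X a * X b ^ 2, X a * X b * X c, X a * X c ^ 3, X b ^ 3, X b ^ 2 * X c ^ 2,
          X b * X c ^ 4, X c ^ 6] : Fin 8 → MvPolynomial (Fin n) k) 7) (Ideal.mem_span_range_self
        (f := (![X a ^ 2, X a * X b ^ 2, X a * X b * X c, X a * X c ^ 3, X b ^ 3, X b ^ 2 * X c ^ 2,
          X b * X c ^ 4, X c ^ 6] : Fin 8 → MvPolynomial (Fin n) k)) (x := 7)) := by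
  apply Subtype.ext
  have e3 : (![X a ^ 2, X a * X b ^ 2, X a * X b * X c, X a * X c ^ 3, X b ^ 3, X b ^ 2 * X c ^ 2,
      X b * X c ^ 4, X c ^ 6] : Fin 8 → MvPolynomial (Fin n) k) 3 = X a * X c ^ 3 := rfl
  have e0 : (![X a ^ 2, X a * X b ^ 2, X a * X b * X c, X a * X c ^ 3, X b ^ 3, X b ^ 2 * X c ^ 2,
      X b * X c ^ 4, X c ^ 6] : Fin 8 → MvPolynomial (Fin n) k) 0 = X a ^ 2 := rfl
  have e7 : (![X a ^ 2, X a * X b ^ 2, X a * X b * X c, X a * X c ^ 3, X b ^ 3, X b ^ 2 * X c ^ 2,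
      X b * X c ^ 4, X c ^ 6] : Fin 8 → MvPolynomial (Fin n) k) 7 = X c ^ 6 := rfl
  simp only [Subalgebra.coe_pow, Subalgebra.coe_mul, coe_reesT, e3, e0, e7,
    Polynomial.monomial_pow, Polynomial.monomial_mul_monomial]
  rw [show ((X a * X c ^ 3) ^ 2 : MvPolynomial (Fin n) k) = X a ^ 2 * X c ^ 6 by ring]

/-- `(x_b² x_c² t)³ = (x_b³ t)² (x_c⁶ t)`. [folklore] -/
theorem reesT_I6_five_cube :
    reesT ((![X a ^ 2, X a * X b ^ 2, X a * X b * X c, X a * X c ^ 3, X b ^ 3, X b ^ 2 * X c ^ 2,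
          X b * X c ^ 4, X c ^ 6] : Fin 8 → MvPolynomial (Fin n) k) 5) (Ideal.mem_span_range_self
        (f := (![X a ^ 2, X a * X b ^ 2, X a * X b * X c, X a * X c ^ 3, X b ^ 3, X b ^ 2 * X c ^ 2,
          X b * X c ^ 4, X c ^ 6] : Fin 8 → MvPolynomial (Fin n) k)) (x := 5)) ^ 3 =
    reesT ((![X a ^ 2, X a * X b ^ 2, X a * X b * X c, X a * X c ^ 3, X b ^ 3, X b ^ 2 * X c ^ 2,
          X b * X c ^ 4, X c ^ 6] : Fin 8 → MvPolynomial (Fin n) k) 4) (Ideal.mem_span_range_self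
        (f := (![X a ^ 2, X a * X b ^ 2, X a * X b * X c, X a * X c ^ 3, X b ^ 3, X b ^ 2 * X c ^ 2,
          X b * X c ^ 4, X c ^ 6] : Fin 8 → MvPolynomial (Fin n) k)) (x := 4)) ^ 2 *
      reesT ((![X a ^ 2, X a * X b ^ 2, X a * X b * X c, X a * X c ^ 3, X b ^ 3, X b ^ 2 * X c ^ 2,
          X b * X c ^ 4, X c ^ 6] : Fin 8 → MvPolynomial (Fin n) k) 7) (Ideal.mem_span_range_self
        (f := (![X a ^ 2, X a * X b ^ 2, X a * X b * X c, X a * X c ^ 3, X b ^ 3, X b ^ 2 * X c ^ 2,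
          X b * X c ^ 4, X c ^ 6] : Fin 8 → MvPolynomial (Fin n) k)) (x := 7)) := by
  apply Subtype.ext
  have e5 : (![X a ^ 2, X a * X b ^ 2, X a * X b * X c, X a * X c ^ 3, X b ^ 3, X b ^ 2 * X c ^ 2,
      X b * X c ^ 4, X c ^ 6] : Fin 8 → MvPolynomial (Fin n) k) 5 = X b ^ 2 * X c ^ 2 := rfl
  have e4 : (![X a ^ 2, X a * X b ^ 2, X a * X b * X c, X a * X c ^ 3, X b ^ 3, X b ^ 2 * X c ^ 2,
      X b * X c ^ 4, X c ^ 6] : Fin 8 → MvPolynomial (Fin n) k) 4 = X b ^ 3 := rfl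
  have e7 : (![X a ^ 2, X a * X b ^ 2, X a * X b * X c, X a * X c ^ 3, X b ^ 3, X b ^ 2 * X c ^ 2,
      X b * X c ^ 4, X c ^ 6] : Fin 8 → MvPolynomial (Fin n) k) 7 = X c ^ 6 := rfl
  simp only [Subalgebra.coe_pow, Subalgebra.coe_mul, coe_reesT, e5, e4, e7,
    Polynomial.monomial_pow, Polynomial.monomial_mul_monomial]
  rw [show ((X b ^ 2 * X c ^ 2) ^ 3 : MvPolynomial (Fin n) k) = (X b ^ 3) ^ 2 * X c ^ 6 by ring]

/-- `(x_b x_c⁴ t)³ = (x_b³ t)(x_c⁶ t)²`. [folklore] -/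
theorem reesT_I6_six_cube :
    reesT ((![X a ^ 2, X a * X b ^ 2, X a * X b * X c, X a * X c ^ 3, X b ^ 3, X b ^ 2 * X c ^ 2,
          X b * X c ^ 4, X c ^ 6] : Fin 8 → MvPolynomial (Fin n) k) 6) (Ideal.mem_span_range_self
        (f := (![X a ^ 2, X a * X b ^ 2, X a * X b * X c, X a * X c ^ 3, X b ^ 3, X b ^ 2 * X c ^ 2,
          X b * X c ^ 4, X c ^ 6] : Fin 8 → MvPolynomial (Fin n) k)) (x := 6)) ^ 3 =
    reesT ((![X a ^ 2, X a * X b ^ 2, X a * X b * X c, X a * X c ^ 3, X b ^ 3, X b ^ 2 * X c ^ 2,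
          X b * X c ^ 4, X c ^ 6] : Fin 8 → MvPolynomial (Fin n) k) 4) (Ideal.mem_span_range_self
        (f := (![X a ^ 2, X a * X b ^ 2, X a * X b * X c, X a * X c ^ 3, X b ^ 3, X b ^ 2 * X c ^ 2,
          X b * X c ^ 4, X c ^ 6] : Fin 8 → MvPolynomial (Fin n) k)) (x := 4)) *
      reesT ((![X a ^ 2, X a * X b ^ 2, X a * X b * X c, X a * X c ^ 3, X b ^ 3, X b ^ 2 * X c ^ 2,
          X b * X c ^ 4, X c ^ 6] : Fin 8 → MvPolynomial (Fin n) k) 7) (Ideal.mem_span_range_self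
        (f := (![X a ^ 2, X a * X b ^ 2, X a * X b * X c, X a * X c ^ 3, X b ^ 3, X b ^ 2 * X c ^ 2,
          X b * X c ^ 4, X c ^ 6] : Fin 8 → MvPolynomial (Fin n) k)) (x := 7)) ^ 2 := by
  apply Subtype.ext
  have e6 : (![X a ^ 2, X a * X b ^ 2, X a * X b * X c, X a * X c ^ 3, X b ^ 3, X b ^ 2 * X c ^ 2,
      X b * X c ^ 4, X c ^ 6] : Fin 8 → MvPolynomial (Fin n) k) 6 = X b * X c ^ 4 := rfl
  have e4 : (![X a ^ 2, X a * X b ^ 2, X a * X b * X c, X a * X c ^ 3, X b ^ 3, X b ^ 2 * X c ^ 2,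
      X b * X c ^ 4, X c ^ 6] : Fin 8 → MvPolynomial (Fin n) k) 4 = X b ^ 3 := rfl
  have e7 : (![X a ^ 2, X a * X b ^ 2, X a * X b * X c, X a * X c ^ 3, X b ^ 3, X b ^ 2 * X c ^ 2,
      X b * X c ^ 4, X c ^ 6] : Fin 8 → MvPolynomial (Fin n) k) 7 = X c ^ 6 := rfl
  simp only [Subalgebra.coe_pow, Subalgebra.coe_mul, coe_reesT, e6, e4, e7,
    Polynomial.monomial_pow, Polynomial.monomial_mul_monomial]
  rw [show ((X b * X c ^ 4) ^ 3 : MvPolynomial (Fin n) k) = X b ^ 3 * (X c ^ 6) ^ 2 by ring]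

/-- `(x_a x_b x_c t)⁶ = (x_a² t)³ (x_b³ t)² (x_c⁶ t)` (the generator `x_a x_b x_c` is the interior
point of the facet). [folklore] -/
theorem reesT_I6_two_pow :
    reesT ((![X a ^ 2, X a * X b ^ 2, X a * X b * X c, X a * X c ^ 3, X b ^ 3, X b ^ 2 * X c ^ 2,
          X b * X c ^ 4, X c ^ 6] : Fin 8 → MvPolynomial (Fin n) k) 2) (Ideal.mem_span_range_self
        (f := (![X a ^ 2, X a * X b ^ 2, X a * X b * X c, X a * X c ^ 3, X b ^ 3, X b ^ 2 * X c ^ 2,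
          X b * X c ^ 4, X c ^ 6] : Fin 8 → MvPolynomial (Fin n) k)) (x := 2)) ^ 6 =
    reesT ((![X a ^ 2, X a * X b ^ 2, X a * X b * X c, X a * X c ^ 3, X b ^ 3, X b ^ 2 * X c ^ 2,
          X b * X c ^ 4, X c ^ 6] : Fin 8 → MvPolynomial (Fin n) k) 0) (Ideal.mem_span_range_self
        (f := (![X a ^ 2, X a * X b ^ 2, X a * X b * X c, X a * X c ^ 3, X b ^ 3, X b ^ 2 * X c ^ 2,
          X b * X c ^ 4, X c ^ 6] : Fin 8 → MvPolynomial (Fin n) k)) (x := 0)) ^ 3 *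
      reesT ((![X a ^ 2, X a * X b ^ 2, X a * X b * X c, X a * X c ^ 3, X b ^ 3, X b ^ 2 * X c ^ 2,
          X b * X c ^ 4, X c ^ 6] : Fin 8 → MvPolynomial (Fin n) k) 4) (Ideal.mem_span_range_self
        (f := (![X a ^ 2, X a * X b ^ 2, X a * X b * X c, X a * X c ^ 3, X b ^ 3, X b ^ 2 * X c ^ 2,
          X b * X c ^ 4, X c ^ 6] : Fin 8 → MvPolynomial (Fin n) k)) (x := 4)) ^ 2 *
      reesT ((![X a ^ 2, X a * X b ^ 2, X a * X b * X c, X a * X c ^ 3, X b ^ 3, X b ^ 2 * X c ^ 2,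
          X b * X c ^ 4, X c ^ 6] : Fin 8 → MvPolynomial (Fin n) k) 7) (Ideal.mem_span_range_self
        (f := (![X a ^ 2, X a * X b ^ 2, X a * X b * X c, X a * X c ^ 3, X b ^ 3, X b ^ 2 * X c ^ 2,
          X b * X c ^ 4, X c ^ 6] : Fin 8 → MvPolynomial (Fin n) k)) (x := 7)) := by
  apply Subtype.ext
  have e2 : (![X a ^ 2, X a * X b ^ 2, X a * X b * X c, X a * X c ^ 3, X b ^ 3, X b ^ 2 * X c ^ 2,
      X b * X c ^ 4, X c ^ 6] : Fin 8 → MvPolynomial (Fin n) k) 2 = X a * X b * X c := rfl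
  have e0 : (![X a ^ 2, X a * X b ^ 2, X a * X b * X c, X a * X c ^ 3, X b ^ 3, X b ^ 2 * X c ^ 2,
      X b * X c ^ 4, X c ^ 6] : Fin 8 → MvPolynomial (Fin n) k) 0 = X a ^ 2 := rfl
  have e4 : (![X a ^ 2, X a * X b ^ 2, X a * X b * X c, X a * X c ^ 3, X b ^ 3, X b ^ 2 * X c ^ 2,
      X b * X c ^ 4, X c ^ 6] : Fin 8 → MvPolynomial (Fin n) k) 4 = X b ^ 3 := rfl
  have e7 : (![X a ^ 2, X a * X b ^ 2, X a * X b * X c, X a * X c ^ 3, X b ^ 3, X b ^ 2 * X c ^ 2,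
      X b * X c ^ 4, X c ^ 6] : Fin 8 → MvPolynomial (Fin n) k) 7 = X c ^ 6 := rfl
  simp only [Subalgebra.coe_pow, Subalgebra.coe_mul, coe_reesT, e2, e0, e4, e7,
    Polynomial.monomial_pow, Polynomial.monomial_mul_monomial]
  rw [show ((X a * X b * X c) ^ 6 : MvPolynomial (Fin n) k) = (X a ^ 2) ^ 3 * (X b ^ 3) ^ 2 * X c ^ 6 by ring]

/-- `(x_a x_b² t)³ = x_a · (x_a² t)(x_b³ t)²` (the generator `x_a x_b²` lies above the facet).
[folklore] -/
theorem reesT_I6_one_cube :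
    reesT ((![X a ^ 2, X a * X b ^ 2, X a * X b * X c, X a * X c ^ 3, X b ^ 3, X b ^ 2 * X c ^ 2,
          X b * X c ^ 4, X c ^ 6] : Fin 8 → MvPolynomial (Fin n) k) 1) (Ideal.mem_span_range_self
        (f := (![X a ^ 2, X a * X b ^ 2, X a * X b * X c, X a * X c ^ 3, X b ^ 3, X b ^ 2 * X c ^ 2,
          X b * X c ^ 4, X c ^ 6] : Fin 8 → MvPolynomial (Fin n) k)) (x := 1)) ^ 3 =
    algebraMap (MvPolynomial (Fin n) k) _ (X a) *
      (reesT ((![X a ^ 2, X a * X b ^ 2, X a * X b * X c, X a * X c ^ 3, X b ^ 3, X b ^ 2 * X c ^ 2,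
          X b * X c ^ 4, X c ^ 6] : Fin 8 → MvPolynomial (Fin n) k) 0) (Ideal.mem_span_range_self
        (f := (![X a ^ 2, X a * X b ^ 2, X a * X b * X c, X a * X c ^ 3, X b ^ 3, X b ^ 2 * X c ^ 2,
          X b * X c ^ 4, X c ^ 6] : Fin 8 → MvPolynomial (Fin n) k)) (x := 0)) *
      reesT ((![X a ^ 2, X a * X b ^ 2, X a * X b * X c, X a * X c ^ 3, X b ^ 3, X b ^ 2 * X c ^ 2,
          X b * X c ^ 4, X c ^ 6] : Fin 8 → MvPolynomial (Fin n) k) 4) (Ideal.mem_span_range_self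
        (f := (![X a ^ 2, X a * X b ^ 2, X a * X b * X c, X a * X c ^ 3, X b ^ 3, X b ^ 2 * X c ^ 2,
          X b * X c ^ 4, X c ^ 6] : Fin 8 → MvPolynomial (Fin n) k)) (x := 4)) ^ 2) := by
  apply Subtype.ext
  have e1 : (![X a ^ 2, X a * X b ^ 2, X a * X b * X c, X a * X c ^ 3, X b ^ 3, X b ^ 2 * X c ^ 2,
      X b * X c ^ 4, X c ^ 6] : Fin 8 → MvPolynomial (Fin n) k) 1 = X a * X b ^ 2 := rfl
  have e0 : (![X a ^ 2, X a * X b ^ 2, X a * X b * X c, X a * X c ^ 3, X b ^ 3, X b ^ 2 * X c ^ 2,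
      X b * X c ^ 4, X c ^ 6] : Fin 8 → MvPolynomial (Fin n) k) 0 = X a ^ 2 := rfl
  have e4 : (![X a ^ 2, X a * X b ^ 2, X a * X b * X c, X a * X c ^ 3, X b ^ 3, X b ^ 2 * X c ^ 2,
      X b * X c ^ 4, X c ^ 6] : Fin 8 → MvPolynomial (Fin n) k) 4 = X b ^ 3 := rfl
  simp only [Subalgebra.coe_pow, Subalgebra.coe_mul, Subalgebra.coe_algebraMap, coe_reesT, e1, e0, e4,
    Polynomial.algebraMap_eq, Polynomial.monomial_pow, Polynomial.C_mul_monomial,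
    Polynomial.monomial_mul_monomial]
  rw [show ((X a * X b ^ 2) ^ 3 : MvPolynomial (Fin n) k) = X a * (X a ^ 2 * (X b ^ 3) ^ 2) by ring]

/-- `D₊(x_a x_c³ t) ⊆ D₊(x_c⁶ t)`: the chart of the edge midpoint `x_a x_c³` lies in the smooth vertex chart. [folklore] -/
theorem basicOpen_I6_three_le :
    Proj.basicOpen (reesGrading (Ideal.span (Set.range
        (![X a ^ 2, X a * X b ^ 2, X a * X b * X c, X a * X c ^ 3, X b ^ 3, X b ^ 2 * X c ^ 2,
          X b * X c ^ 4, X c ^ 6] : Fin 8 → MvPolynomial (Fin n) k))))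
      (reesT ((![X a ^ 2, X a * X b ^ 2, X a * X b * X c, X a * X c ^ 3, X b ^ 3, X b ^ 2 * X c ^ 2,
          X b * X c ^ 4, X c ^ 6] : Fin 8 → MvPolynomial (Fin n) k) 3) (Ideal.mem_span_range_self
        (f := (![X a ^ 2, X a * X b ^ 2, X a * X b * X c, X a * X c ^ 3, X b ^ 3, X b ^ 2 * X c ^ 2,
          X b * X c ^ 4, X c ^ 6] : Fin 8 → MvPolynomial (Fin n) k)) (x := 3))) ≤
      Proj.basicOpen (reesGrading (Ideal.span (Set.range
        (![X a ^ 2, X a * X b ^ 2, X a * X b * X c, X a * X c ^ 3, X b ^ 3, X b ^ 2 * X c ^ 2,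
          X b * X c ^ 4, X c ^ 6] : Fin 8 → MvPolynomial (Fin n) k))))
      (reesT ((![X a ^ 2, X a * X b ^ 2, X a * X b * X c, X a * X c ^ 3, X b ^ 3, X b ^ 2 * X c ^ 2,
          X b * X c ^ 4, X c ^ 6] : Fin 8 → MvPolynomial (Fin n) k) 7) (Ideal.mem_span_range_self
        (f := (![X a ^ 2, X a * X b ^ 2, X a * X b * X c, X a * X c ^ 3, X b ^ 3, X b ^ 2 * X c ^ 2,
          X b * X c ^ 4, X c ^ 6] : Fin 8 → MvPolynomial (Fin n) k)) (x := 7))) := by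
  rw [← Proj.basicOpen_pow _ _ 2 two_pos, reesT_I6_three_sq, Proj.basicOpen_mul]
  exact inf_le_right
/-- `D₊(x_a x_b x_c t) ⊆ D₊(x_c⁶ t)` (the facet-interior generator: the torus chart). [folklore] -/
theorem basicOpen_I6_two_le :
    Proj.basicOpen (reesGrading (Ideal.span (Set.range
        (![X a ^ 2, X a * X b ^ 2, X a * X b * X c, X a * X c ^ 3, X b ^ 3, X b ^ 2 * X c ^ 2,
          X b * X c ^ 4, X c ^ 6] : Fin 8 → MvPolynomial (Fin n) k))))
      (reesT ((![X a ^ 2, X a * X b ^ 2, X a * X b * X c, X a * X c ^ 3, X b ^ 3, X b ^ 2 * X c ^ 2,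
          X b * X c ^ 4, X c ^ 6] : Fin 8 → MvPolynomial (Fin n) k) 2) (Ideal.mem_span_range_self
        (f := (![X a ^ 2, X a * X b ^ 2, X a * X b * X c, X a * X c ^ 3, X b ^ 3, X b ^ 2 * X c ^ 2,
          X b * X c ^ 4, X c ^ 6] : Fin 8 → MvPolynomial (Fin n) k)) (x := 2))) ≤
      Proj.basicOpen (reesGrading (Ideal.span (Set.range
        (![X a ^ 2, X a * X b ^ 2, X a * X b * X c, X a * X c ^ 3, X b ^ 3, X b ^ 2 * X c ^ 2,
          X b * X c ^ 4, X c ^ 6] : Fin 8 → MvPolynomial (Fin n) k))))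
      (reesT ((![X a ^ 2, X a * X b ^ 2, X a * X b * X c, X a * X c ^ 3, X b ^ 3, X b ^ 2 * X c ^ 2,
          X b * X c ^ 4, X c ^ 6] : Fin 8 → MvPolynomial (Fin n) k) 7) (Ideal.mem_span_range_self
        (f := (![X a ^ 2, X a * X b ^ 2, X a * X b * X c, X a * X c ^ 3, X b ^ 3, X b ^ 2 * X c ^ 2,
          X b * X c ^ 4, X c ^ 6] : Fin 8 → MvPolynomial (Fin n) k)) (x := 7))) := by
  rw [← Proj.basicOpen_pow _ _ 6 (by norm_num), reesT_I6_two_pow, Proj.basicOpen_mul]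
  exact inf_le_right
/-- `D₊(x_b² x_c² t) ⊆ D₊(x_c⁶ t)`. [folklore] -/
theorem basicOpen_I6_five_le :
    Proj.basicOpen (reesGrading (Ideal.span (Set.range
        (![X a ^ 2, X a * X b ^ 2, X a * X b * X c, X a * X c ^ 3, X b ^ 3, X b ^ 2 * X c ^ 2,
          X b * X c ^ 4, X c ^ 6] : Fin 8 → MvPolynomial (Fin n) k))))
      (reesT ((![X a ^ 2, X a * X b ^ 2, X a * X b * X c, X a * X c ^ 3, X b ^ 3, X b ^ 2 * X c ^ 2,
          X b * X c ^ 4, X c ^ 6] : Fin 8 → MvPolynomial (Fin n) k) 5) (Ideal.mem_span_range_self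
        (f := (![X a ^ 2, X a * X b ^ 2, X a * X b * X c, X a * X c ^ 3, X b ^ 3, X b ^ 2 * X c ^ 2,
          X b * X c ^ 4, X c ^ 6] : Fin 8 → MvPolynomial (Fin n) k)) (x := 5))) ≤
      Proj.basicOpen (reesGrading (Ideal.span (Set.range
        (![X a ^ 2, X a * X b ^ 2, X a * X b * X c, X a * X c ^ 3, X b ^ 3, X b ^ 2 * X c ^ 2,
          X b * X c ^ 4, X c ^ 6] : Fin 8 → MvPolynomial (Fin n) k))))
      (reesT ((![X a ^ 2, X a * X b ^ 2, X a * X b * X c, X a * X c ^ 3, X b ^ 3, X b ^ 2 * X c ^ 2,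
          X b * X c ^ 4, X c ^ 6] : Fin 8 → MvPolynomial (Fin n) k) 7) (Ideal.mem_span_range_self
        (f := (![X a ^ 2, X a * X b ^ 2, X a * X b * X c, X a * X c ^ 3, X b ^ 3, X b ^ 2 * X c ^ 2,
          X b * X c ^ 4, X c ^ 6] : Fin 8 → MvPolynomial (Fin n) k)) (x := 7))) := by
  rw [← Proj.basicOpen_pow _ _ 3 (by norm_num), reesT_I6_five_cube, Proj.basicOpen_mul]
  exact inf_le_right
/-- `D₊(x_b x_c⁴ t) ⊆ D₊(x_c⁶ t)`. [folklore] -/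
theorem basicOpen_I6_six_le :
    Proj.basicOpen (reesGrading (Ideal.span (Set.range
        (![X a ^ 2, X a * X b ^ 2, X a * X b * X c, X a * X c ^ 3, X b ^ 3, X b ^ 2 * X c ^ 2,
          X b * X c ^ 4, X c ^ 6] : Fin 8 → MvPolynomial (Fin n) k))))
      (reesT ((![X a ^ 2, X a * X b ^ 2, X a * X b * X c, X a * X c ^ 3, X b ^ 3, X b ^ 2 * X c ^ 2,
          X b * X c ^ 4, X c ^ 6] : Fin 8 → MvPolynomial (Fin n) k) 6) (Ideal.mem_span_range_self
        (f := (![X a ^ 2, X a * X b ^ 2, X a * X b * X c, X a * X c ^ 3, X b ^ 3, X b ^ 2 * X c ^ 2,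
          X b * X c ^ 4, X c ^ 6] : Fin 8 → MvPolynomial (Fin n) k)) (x := 6))) ≤
      Proj.basicOpen (reesGrading (Ideal.span (Set.range
        (![X a ^ 2, X a * X b ^ 2, X a * X b * X c, X a * X c ^ 3, X b ^ 3, X b ^ 2 * X c ^ 2,
          X b * X c ^ 4, X c ^ 6] : Fin 8 → MvPolynomial (Fin n) k))))
      (reesT ((![X a ^ 2, X a * X b ^ 2, X a * X b * X c, X a * X c ^ 3, X b ^ 3, X b ^ 2 * X c ^ 2,
          X b * X c ^ 4, X c ^ 6] : Fin 8 → MvPolynomial (Fin n) k) 7) (Ideal.mem_span_range_self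
        (f := (![X a ^ 2, X a * X b ^ 2, X a * X b * X c, X a * X c ^ 3, X b ^ 3, X b ^ 2 * X c ^ 2,
          X b * X c ^ 4, X c ^ 6] : Fin 8 → MvPolynomial (Fin n) k)) (x := 7))) := by
  rw [← Proj.basicOpen_pow _ _ 3 (by norm_num), reesT_I6_six_cube, Proj.basicOpen_mul,
    Proj.basicOpen_pow _ _ 2 two_pos]
  exact inf_le_right
/-- `D₊(x_a x_b² t) ⊆ D₊(x_a² t)` (the generator `x_a x_b²` of weight `7` lies above the facet; its chart lies in the `⅓`-vertex chart). [folklore] -/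
theorem basicOpen_I6_one_le :
    Proj.basicOpen (reesGrading (Ideal.span (Set.range
        (![X a ^ 2, X a * X b ^ 2, X a * X b * X c, X a * X c ^ 3, X b ^ 3, X b ^ 2 * X c ^ 2,
          X b * X c ^ 4, X c ^ 6] : Fin 8 → MvPolynomial (Fin n) k))))
      (reesT ((![X a ^ 2, X a * X b ^ 2, X a * X b * X c, X a * X c ^ 3, X b ^ 3, X b ^ 2 * X c ^ 2,
          X b * X c ^ 4, X c ^ 6] : Fin 8 → MvPolynomial (Fin n) k) 1) (Ideal.mem_span_range_self
        (f := (![X a ^ 2, X a * X b ^ 2, X a * X b * X c, X a * X c ^ 3, X b ^ 3, X b ^ 2 * X c ^ 2,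
          X b * X c ^ 4, X c ^ 6] : Fin 8 → MvPolynomial (Fin n) k)) (x := 1))) ≤
      Proj.basicOpen (reesGrading (Ideal.span (Set.range
        (![X a ^ 2, X a * X b ^ 2, X a * X b * X c, X a * X c ^ 3, X b ^ 3, X b ^ 2 * X c ^ 2,
          X b * X c ^ 4, X c ^ 6] : Fin 8 → MvPolynomial (Fin n) k))))
      (reesT ((![X a ^ 2, X a * X b ^ 2, X a * X b * X c, X a * X c ^ 3, X b ^ 3, X b ^ 2 * X c ^ 2,
          X b * X c ^ 4, X c ^ 6] : Fin 8 → MvPolynomial (Fin n) k) 0) (Ideal.mem_span_range_self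
        (f := (![X a ^ 2, X a * X b ^ 2, X a * X b * X c, X a * X c ^ 3, X b ^ 3, X b ^ 2 * X c ^ 2,
          X b * X c ^ 4, X c ^ 6] : Fin 8 → MvPolynomial (Fin n) k)) (x := 0))) := by
  rw [← Proj.basicOpen_pow _ _ 3 (by norm_num), reesT_I6_one_cube, Proj.basicOpen_mul,
    Proj.basicOpen_mul, Proj.basicOpen_pow _ _ 2 two_pos]
  exact inf_le_right.trans inf_le_left

end Containments

end Summit.ResolutionOfSingularities.ResolutionOfSingularities.Theorems.WildQuotientResolution.JordanFour

end
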